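import Mathlib
import Summits.KontsevichZagierPeriods.Zeta5Search.RVLargeParamMidCases
import HarnessLib

/-!
# RVLargeParamZCoverMid — the mid band is PROVED: `LargeParamZCoverMidPos`, hence (CV⁺) and `FlatGaugeLawF1` (fam-rv gen 10, file 3; #10.3)

HONEST FRAMING: systematic search; no irrationality claim unless certified.  The last open node of the large-parameter chain,
`LargeParamZCoverMidPos` (file 8, `RVLargeParamZCoverBonus.lean`): in the regime (`b`, `b + e_j` in the polytope, designated
slot `i`, other blocks short) with `lpBonus ≥ 1` and `−5 ≤ t := −N_p(b) + lpBonus ≤ −4`, both constant terms pass one of the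
four proved configuration tests at `t`.  PROOF (`midBand_provedPair`): `N_p ≥ 1` makes `B_i` long, so `i` carries the least
parameter strictly and the SETTING of file 10.1 holds for `b` AND for `b + e_j` (entries only grow; `nbig`, shortness and
minimality persist, `N_p` does not increase, `d` drops by one); `lpBonus ≤ nbig`, `lpBonus ≤ [LP] + [2p ≤ d]` leave three cases:
`t = −5` ⇒ the palindromic case at `−6` for both vectors (file 10.2 (A)); `t = −4`, `2p ≤ d` ⇒ the zero-layer case for both
((B): `N ≤ 6`, and `N = 5` when `lpBonus = 1`, `nbig ≥ 2` when `lpBonus = 2`); `t = −4`, `d < 2p` ⇒ `[LP] = 1`, `N = 5`, the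
LP partner gives the counting case for `b` ((B')), which passes to `b + e_j` (`countingCase_shift_of`).
CONSEQUENCES (with files 7–9.6b, all proved): `LargeParamZCover`, (V⁺) `LargeParamVFloor`, (CV⁺) `LargeParamClassLaw` and
`FlatGaugeLawF1` hold outright — the flat gauge `v_p(Casoratian_j(b)) ≥ −N_p(b) + lpBonus(b,p)` on the window (F1)
(`b₀ + 2 < p²`, one long block) is a THEOREM.  Integer/`p`-adic bookkeeping only; nothing about irrationality.
-/

noncomputable section

open Finset

namespace Summit.KontsevichZagierPeriods.Zeta5Search.ClusterValuation

open Summit.KontsevichZagierPeriods.Zeta5Search.DualSeries (InBox)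
open Summit.KontsevichZagierPeriods.Zeta5Search.WedgeDictionary (dOf)
open Summit.KontsevichZagierPeriods.Zeta5Search.CasoratianValuation (InPolytope pairFloors shift)
open Summit.KontsevichZagierPeriods.Zeta5Search.RVFlatGauge (countingCase palCase provedCaseZ)
open Summit.KontsevichZagierPeriods.Zeta5Search.RVFlatGauge.Cap (nbig lpUnit lpBonus lpUnit_nonneg lpUnit_le_one
  lpBonus_nonneg)
open Summit.KontsevichZagierPeriods.Zeta5Search.BigPrime (shift_zero dOf_shift)

variable {p : ℕ}

/-! ### The regime forces the setting -/

/-- **`N_p ≥ 1` makes the designated block long:** if every block were short, every pair floor would vanish. -/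
theorem long_of_pairFloors_pos (b : ℕ → ℤ) (hb : InPolytope b) {i : ℕ}
    (hshort : ∀ k ∈ (range 7).erase i, b 0 - 2 * b (k + 1) < p) (hN : 1 ≤ pairFloors b p) :
    (p : ℤ) ≤ b 0 - 2 * b (i + 1) := by
  by_contra hlong
  push Not at hlong
  have hall : ∀ k ∈ range 7, b 0 - 2 * b (k + 1) < p := by
    intro k hk
    by_cases hki : k = i
    · rw [hki]; exact hlong
    · exact hshort k (mem_erase.2 ⟨hki, hk⟩)
  have h0 : pairFloors b p = 0 := by
    unfold pairFloors
    refine sum_eq_zero fun a ha => sum_eq_zero fun k hk => ?_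
    split_ifs with hak
    · have h2a := hb.2.1 a ha
      have h2k := hb.2.1 k hk
      have ha' := hall a ha
      have hk' := hall k hk
      exact Int.ediv_eq_zero_of_lt (by omega) (by omega)
    · rfl
  omega

/-- The shifted entries: `b_k ≤ (b + e_j)_k ≤ b_k + 1`. -/
theorem shift_succ_bounds (b : ℕ → ℤ) (j k : ℕ) : b (k + 1) ≤ shift b j (k + 1) ∧ shift b j (k + 1) ≤ b (k + 1) + 1 := by
  unfold shift Function.update
  split_ifs with h
  · subst h; constructor <;> simp
  · constructor <;> simp

/-- `nbig` does not decrease under the shift. -/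
theorem nbig_le_nbig_shift (b : ℕ → ℤ) (j p : ℕ) : nbig b p ≤ nbig (shift b j) p := by
  unfold nbig
  exact card_le_card fun k hk => mem_filter.2 ⟨mem_univ _,
    (mem_filter.1 hk).2.trans (shift_succ_bounds b j k.val).1⟩

/-! ### The mid band, both constant terms -/

/-- **MID BAND, BOTH CONSTANT TERMS:** in the regime, `1 ≤ lpBonus` and `−5 ≤ −N_p + lpBonus ≤ −4` make `b` and `b + e_j`
pass a proved configuration test at `−N_p + lpBonus`. -/
theorem midBand_provedPair (b : ℕ → ℤ) {j i : ℕ} (hb : InPolytope b) (hj1 : 1 ≤ j) (hj7 : j ≤ 7)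
    (hb' : InPolytope (shift b j)) (hp : 0 < p) (hshort : ∀ k ∈ (range 7).erase i, b 0 - 2 * b (k + 1) < p)
    (h1 : 1 ≤ lpBonus b p) (ht5 : -5 ≤ -pairFloors b p + lpBonus b p) (ht4 : -pairFloors b p + lpBonus b p ≤ -4) :
    provedCaseZ b p (-pairFloors b p + lpBonus b p) = true ∧
      provedCaseZ (shift b j) p (-pairFloors b p + lpBonus b p) = true := by
  -- a designated slot inside `range 7`
  obtain ⟨i₀, hi₀, hshort₀⟩ : ∃ i₀ ∈ range 7, ∀ k ∈ (range 7).erase i₀, b 0 - 2 * b (k + 1) < p := by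
    by_cases hi : i ∈ range 7
    · exact ⟨i, hi, hshort⟩
    · refine ⟨0, by simp, fun k hk => hshort k (mem_erase.2 ⟨?_, (mem_erase.1 hk).2⟩)⟩
      rintro rfl
      exact hi (mem_erase.1 hk).2
  set t := -pairFloors b p + lpBonus b p with ht
  -- shape of the band
  have hnb := lpBonus_le_nbig b p
  have hlp := lpBonus_le_lp_add b p
  have hu1 := lpUnit_le_one b p
  have hl2 : lpBonus b p ≤ 2 := by split_ifs at hlp <;> omega
  have hn1 : 1 ≤ nbig b p := by exact_mod_cast h1.trans hnb
  -- the setting for `b`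
  have hlong := long_of_pairFloors_pos b hb hshort₀ (by omega)
  have hmin : ∀ k ∈ range 7, b (i₀ + 1) ≤ b (k + 1) := by
    intro k hk
    by_cases hki : k = i₀
    · rw [hki]
    · have := hshort₀ k (mem_erase.2 ⟨hki, hk⟩); omega
  -- the setting for `b + e_j`
  have hc0 : shift b j 0 = b 0 := shift_zero b hj1
  have hshortc : ∀ k ∈ (range 7).erase i₀, shift b j 0 - 2 * shift b j (k + 1) < p := fun k hk => by
    have := hshort₀ k hk; have := (shift_succ_bounds b j k).1; rw [hc0]; omega
  have hminc : ∀ k ∈ range 7, shift b j (i₀ + 1) ≤ shift b j (k + 1) := by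
    intro k hk
    by_cases hki : k = i₀
    · rw [hki]
    · have := hshort₀ k (mem_erase.2 ⟨hki, hk⟩)
      have := (shift_succ_bounds b j k).1; have := (shift_succ_bounds b j i₀).2; omega
  have hn1c : 1 ≤ nbig (shift b j) p := hn1.trans (nbig_le_nbig_shift b j p)
  have hNc := pairFloors_shift_le b hj1 p hp
  have hdc := dOf_shift b hj1 hj7
  -- the three cases
  rcases (show t = -5 ∨ t = -4 by omega) with h5 | h4
  · -- `t = −5`: the palindromic case at `−6` for both
    have hA := palCase_neg_six b hb hp hi₀ hmin hshort₀ hn1 (by omega)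
    have hAc := palCase_neg_six (shift b j) hb' hp hi₀ hminc hshortc hn1c (by omega)
    rw [h5]
    simp only [provedCaseZ, Bool.or_eq_true]
    exact ⟨Or.inl (Or.inl (Or.inr (by norm_num; exact hA))), Or.inl (Or.inl (Or.inr (by norm_num; exact hAc)))⟩
  · rw [h4]
    by_cases hd : 2 * (p : ℤ) ≤ dOf b
    · -- `t = −4`, `2p ≤ d`: the zero-layer case for both
      have hM : pairFloors b p ≤ 5 ∨ 2 ≤ nbig b p := by
        rcases (show lpBonus b p = 1 ∨ lpBonus b p = 2 by omega) with h | h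
        · exact Or.inl (by omega)
        · exact Or.inr (by exact_mod_cast h.symm.le.trans hnb)
      have hB := zLayerCase_neg_four b hb hp hi₀ hmin hshort₀ hn1 (by omega) (by omega) hM
      have hMc : pairFloors (shift b j) p ≤ 5 ∨ 2 ≤ nbig (shift b j) p :=
        hM.imp (fun h => hNc.trans h) fun h => h.trans (nbig_le_nbig_shift b j p)
      have hBc := zLayerCase_neg_four (shift b j) hb' hp hi₀ hminc hshortc hn1c (by omega) (by omega) hMc
      simp only [provedCaseZ, Bool.or_eq_true]
      exact ⟨Or.inr hB, Or.inr hBc⟩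
    · -- `t = −4`, `d < 2p`: `[LP] = 1`, `N = 5`; counting for `b` via the LP partner, then for `b + e_j`
      rw [if_neg hd] at hlp
      have hlpu : lpUnit b p = 1 := by omega
      obtain ⟨-, k, hk, hβk, hAk⟩ := lp_partner b hshort₀ hlpu
      have hB := countingCase_neg_four_of_partner b hb hp hi₀ hmin hshort₀ (by omega) hk hβk hAk
      have hBc := countingCase_shift_of b hb.1 hj1 hB
      simp only [provedCaseZ, Bool.or_eq_true]
      exact ⟨Or.inl (Or.inl (Or.inl hB)), Or.inl (Or.inl (Or.inl hBc))⟩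

end Summit.KontsevichZagierPeriods.Zeta5Search.ClusterValuation

/-! ### The node and its consequences -/

namespace Summit.KontsevichZagierPeriods.Zeta5Search.RVFlatGauge

open Summit.KontsevichZagierPeriods.Zeta5Search.ClusterValuation (midBand_provedPair)

/-- **THE NODE `LargeParamZCoverMidPos` OF FILE 8 HOLDS.** -/
theorem largeParamZCoverMidPos_holds : LargeParamZCoverMidPos :=
  fun b _ _ _ hb hj1 hj7 hb' hpr _ _ hshort h1 ht5 ht4 => midBand_provedPair b hb hj1 hj7 hb' hpr.pos hshort h1 ht5 ht4

/-- Hence the mid band `LargeParamZCoverMid` (file 7). -/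
theorem largeParamZCoverMid_holds : LargeParamZCoverMid :=
  largeParamZCoverMid_of_pos largeParamZCoverMidPos_holds

/-- **THE COMBINATORIAL COVER `LargeParamZCover` (file 6) HOLDS.** -/
theorem largeParamZCover_holds : LargeParamZCover :=
  largeParamZCover_of_midPos largeParamZCoverMidPos_holds

/-- **(V⁺) `LargeParamVFloor` HOLDS:** `v_p(constant term) ≥ −N_p + lpBonus` on the window, in the large-parameter regime. -/
theorem largeParamVFloor_holds : LargeParamVFloor :=
  largeParamVFloor_of_midPos largeParamZCoverMidPos_holds

/-- **(CV⁺) `LargeParamClassLaw` HOLDS.** -/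
theorem largeParamClassLaw_holds : LargeParamClassLaw :=
  largeParamClassLaw_of_midPos largeParamZCoverMidPos_holds

/-- **`FlatGaugeLawF1` HOLDS:** the flat gauge of the Casoratian on the window (F1) is a theorem. -/
theorem flatGaugeLawF1_holds : FlatGaugeLawF1 :=
  flatGaugeLawF1_of_midPos largeParamZCoverMidPos_holds

end Summit.KontsevichZagierPeriods.Zeta5Search.RVFlatGauge

end
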